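import Literature.NumberTheory.EllipticCurves.GrossZagierSingularModuliClassNumberOne
import Literature.NumberTheory.EllipticCurves.SingularModuliConjugate
import HarnessLib

/-!
# `J(d₁, d₂)` as the resultant of the class polynomials: `J(d₁,d₂) = ∏_{Q ∈ red(d₁)} H_{d₂}(j(τ_Q))`
# (Gross–Zagier 1985, §1; Lauter–Viray 2015, §1; Li–Yang 2020, Thm. 1.4 "the resultant of the class
# polynomials … which is the norm of the difference")

Topic `NumberTheory/EllipticCurves` (singular moduli); theorem-only bridge (no definition, no named
fact, D-0026) between the two carriers of the tree:

* the Gross–Zagier carrier `GrossZagier1985.J d₁ d₂ = ∏_{f ∈ BinQF.reducedFormsList d₁}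
  ∏_{g ∈ BinQF.reducedFormsList d₂} (j(τ_f) − j(τ_g))` of `GrossZagierSingularModuli.lean` (typing of
  [GZ85, Thm. 1.3]; lists of `Quadratic.BinQF`), and
* the class-polynomial carrier `classPolynomial D = ∏_{Q ∈ reducedForms D} (X − C (formJ Q))` of
  `ComplexMultiplicationJInvariantProofs.lean` (Cox Prop. 13.2; finsets of triples `ℤ × ℤ × ℤ`), the
  vocabulary in which every census of singular moduli in this tree is written
  (`Summits/HodgeConjecture/HodgeLocus/Census/SingularModuli*.lean`).

Proved here, for `d₁, d₂ < 0`: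

* `prod_reducedFormsList_eq_prod_reducedForms` — the two enumerations of the reduced primitive
  positive definite forms of discriminant `D < 0` agree as indexing sets of products
  (`BinQF.mem_reducedFormsList_iff` / `mem_reducedForms_iff`, `BinQF.nodup_reducedFormsList`);
* `J_eq_prod_prod` — `J(d₁, d₂) = ∏_{Q₁ ∈ reducedForms d₁} ∏_{Q₂ ∈ reducedForms d₂} (j(τ_{Q₁}) − j(τ_{Q₂}))`;
* `J_eq_prod_eval_classPolynomial` — **`J(d₁, d₂) = ∏_{Q ∈ reducedForms d₁} H_{d₂}(j(τ_Q))`**, the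
  resultant `Res(H_{d₁}, H_{d₂})` written as a product of values ("the resultant of the class
  polynomials of `j((d₁+√d₁)/2)` and `j((d₂+√d₂)/2)`, which is the norm of the difference", Li–Yang
  §1, p. 3); `J_eq_sign_mul_prod_eval_classPolynomial` — the same through `H_{d₁}` with the sign
  `(−1)^{h₁h₂}`; `J_eq_resultant` — **`J(d₁, d₂) = Polynomial.resultant H_{d₁} H_{d₂}`** literally
  (Mathlib's Sylvester resultant, via `Polynomial.resultant_eq_prod_eval`; with the bookkeeping
  `monic_classPolynomial` and the roots of `H_D`);
* `grossZagier1985_singularModuli.resultant_pow_eight` — **[GZ85, Thm. 1.3] in the census's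
  vocabulary** (a COROLLARY of the named fact, taken as hypothesis `h`): for coprime negative
  fundamental discriminants, `(∏_{Q ∈ reducedForms d₁} H_{d₂}(j(τ_Q)))^8 = (∏ₓ F((d₁d₂ − x²)/4))^{w₁w₂}`;
  and `resultant_pow_eight_of_mem_cmDiscrs` — the same UNCONDITIONALLY on the nine class-number-one
  fundamental discriminants (from `grossZagier1985_singularModuli_of_mem_cmDiscrs`); both also with
  Mathlib's resultant (`…resultant_classPolynomial_pow_eight`,
  `resultant_classPolynomial_pow_eight_of_mem_cmDiscrs`: `Res(H_{d₁}, H_{d₂})^8 = (∏ₓ F(…))^{w₁w₂}`).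

Nothing new mathematically: bookkeeping between two encodings of Cox's reduced forms (Thm. 2.8) so that
the typed theorem can be cited against the census's `classPolynomial`/`Res(H_{d₁}, H_{d₂})` rows.

## References

* [GrossZagier1985SingularModuli] B. H. Gross, D. B. Zagier, *On singular moduli*, J. reine angew.
  Math. 355 (1985), §1, Thm. 1.3.
* [LiYang2020YuiZagier] Y. Li, T. Yang, *On a conjecture of Yui and Zagier*, Algebra Number Theory 14
  (2020) 2197–2238 = arXiv:1911.09589, §1 p. 3 and Thm. 1.4 ("Theorem 1.3 in [GZ]").
* [Cox2013] D. A. Cox, *Primes of the form x² + ny²*, 2nd ed., Thm. 2.8 (reduced forms), §13.A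
  Prop. 13.2 (class polynomial), Thm. 13.24.
-/

noncomputable section

open scoped NumberTheorySymbols

namespace Literature.NumberTheory.EllipticCurves

open Polynomial
open Literature.NumberTheory.QuadraticFields.Quadratic (BinQF)
open Literature.NumberTheory.QuadraticFields.BinaryQuadraticForm
open Literature.NumberTheory.EllipticCurves.ModularForms

/-! ### Class-polynomial bookkeeping: `H_D` is monic; its roots -/

/-- `H_D = ∏_{Q ∈ red(D)} (X − j(τ_Q))` is monic. [cite: Cox2013, §13.A Prop. 13.2] -/
theorem monic_classPolynomial (D : ℤ) : (classPolynomial D).Monic := by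
  rw [classPolynomial]
  exact monic_prod_of_monic _ _ fun Q _ => monic_X_sub_C _

/-- The multiset of roots of `H_D` is `{j(τ_Q) : Q ∈ reducedForms D}` — a private copy, for use below,
of the Summits-side `roots_classPolynomial` (`Summits/HodgeConjecture/HodgeLocus/Census/
SingularModuliRealRoots.lean`), which a Literature file cannot import. [cite: Cox2013, §13.A Prop. 13.2] -/
private theorem classPolynomial_roots_eq_map_formJ (D : ℤ) :
    (classPolynomial D).roots = (reducedForms D).val.map formJ := by
  have h : (reducedForms D).val.map (fun Q => X - C (formJ Q)) =
      ((reducedForms D).val.map formJ).map (fun a => X - C a) := by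
    rw [Multiset.map_map]; rfl
  rw [classPolynomial, Finset.prod_eq_multiset_prod, h, Polynomial.roots_multiset_prod_X_sub_C]

namespace GrossZagier1985

/-! ### The two enumerations of reduced forms index the same products -/

/-- **`BinQF.reducedFormsList D` and `reducedForms D` enumerate the same forms** (`D < 0`): a product
over the list of reduced `BinQF`s, read through the coefficient triple `(a, b, c)`, equals the product
over the finset `reducedForms D` of triples (both are "the reduced primitive positive definite forms of
discriminant `D`", Cox Thm. 2.8; the list is duplicate-free). [cite: Cox2013, §2.A Thm. 2.8] -/
theorem prod_reducedFormsList_eq_prod_reducedForms {M : Type*} [CommMonoid M] {D : ℤ} (hD : D < 0)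
    (φ : ℤ × ℤ × ℤ → M) :
    ((BinQF.reducedFormsList D).map fun f => φ (f.a, f.b, f.c)).prod = ∏ Q ∈ reducedForms D, φ Q := by
  classical
  have hinj : Function.Injective fun f : BinQF => (f.a, f.b, f.c) := by
    intro f g h
    obtain ⟨a, b, c⟩ := f
    obtain ⟨a', b', c'⟩ := g
    simp only [Prod.mk.injEq] at h
    obtain ⟨rfl, rfl, rfl⟩ := h
    rfl
  have hnd : ((BinQF.reducedFormsList D).map fun f : BinQF => (f.a, f.b, f.c)).Nodup :=
    (BinQF.nodup_reducedFormsList D).map hinj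
  have hset : ((BinQF.reducedFormsList D).map fun f : BinQF => (f.a, f.b, f.c)).toFinset =
      reducedForms D := by
    ext ⟨a, b, c⟩
    rw [List.mem_toFinset, List.mem_map, mem_reducedForms_iff hD]
    constructor
    · rintro ⟨⟨a', b', c'⟩, hf, h⟩
      simp only [Prod.mk.injEq] at h
      obtain ⟨rfl, rfl, rfl⟩ := h
      obtain ⟨⟨hdisc, ha, hprim⟩, hred⟩ := (BinQF.mem_reducedFormsList_iff _ hD).1 hf
      exact ⟨hdisc, ha, hprim, (isReduced_iff _ _ _).2 hred⟩
    · rintro ⟨hdisc, ha, hprim, hred⟩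
      exact ⟨⟨a, b, c⟩, (BinQF.mem_reducedFormsList_iff _ hD).2
        ⟨⟨hdisc, ha, hprim⟩, (isReduced_iff _ _ _).1 hred⟩, rfl⟩
  rw [← hset, List.prod_toFinset _ hnd, List.map_map]
  rfl

/-- The singular modulus of the GZ carrier at a `BinQF` is the census carrier `formJ` at its
coefficient triple: `kleinJ (formTau f) = formJ (f.a, f.b, f.c)` — the tree's `formJ_eq_kleinJ`
(`SingularModuliConjugate.lean`) read backwards through `formTau f := heegnerTau (f.a, f.b, f.c)`;
a private rewriting convenience, not a new statement. [folklore] -/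
private theorem kleinJ_formTau_eq_formJ (f : BinQF) : kleinJ (formTau f) = formJ (f.a, f.b, f.c) :=
  (formJ_eq_kleinJ _).symm

/-! ### `J(d₁, d₂)` as a double product over the census's reduced forms, and as a resultant -/

/-- **`J(d₁, d₂) = ∏_{Q₁ ∈ red(d₁)} ∏_{Q₂ ∈ red(d₂)} (j(τ_{Q₁}) − j(τ_{Q₂}))`** over the census carrier
`reducedForms` (`d₁, d₂ < 0`). [cite: GrossZagier1985SingularModuli, §1 (definition of J)] -/
theorem J_eq_prod_prod {d₁ d₂ : ℤ} (hd₁ : d₁ < 0) (hd₂ : d₂ < 0) :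
    J d₁ d₂ = ∏ Q₁ ∈ reducedForms d₁, ∏ Q₂ ∈ reducedForms d₂, (formJ Q₁ - formJ Q₂) := by
  unfold J
  have inner : ∀ f : BinQF,
      ((BinQF.reducedFormsList d₂).map fun g => kleinJ (formTau f) - kleinJ (formTau g)).prod =
        ∏ Q₂ ∈ reducedForms d₂, (formJ (f.a, f.b, f.c) - formJ Q₂) := by
    intro f
    rw [← prod_reducedFormsList_eq_prod_reducedForms hd₂ (fun Q₂ => formJ (f.a, f.b, f.c) - formJ Q₂)]
    congr 1
    refine List.map_congr_left fun g _ => ?_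
    rw [kleinJ_formTau_eq_formJ, kleinJ_formTau_eq_formJ]
  rw [← prod_reducedFormsList_eq_prod_reducedForms hd₁
    (fun Q₁ => ∏ Q₂ ∈ reducedForms d₂, (formJ Q₁ - formJ Q₂))]
  congr 1
  exact List.map_congr_left fun f _ => inner f

/-- **`J(d₁, d₂) = ∏_{Q ∈ red(d₁)} H_{d₂}(j(τ_Q))` — the resultant of the class polynomials as a product
of values** (`d₁, d₂ < 0`; "the resultant of the class polynomials of `j((d₁+√d₁)/2)` and
`j((d₂+√d₂)/2)`, which is the norm of the difference").
[cite: LiYang2020YuiZagier, §1 p. 3] [cite: GrossZagier1985SingularModuli, §1] -/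
theorem J_eq_prod_eval_classPolynomial {d₁ d₂ : ℤ} (hd₁ : d₁ < 0) (hd₂ : d₂ < 0) :
    J d₁ d₂ = ∏ Q ∈ reducedForms d₁, (classPolynomial d₂).eval (formJ Q) := by
  rw [J_eq_prod_prod hd₁ hd₂]
  refine Finset.prod_congr rfl fun Q _ => ?_
  rw [classPolynomial, eval_prod]
  simp only [eval_sub, eval_X, eval_C]

/-- The same through `H_{d₁}`: `J(d₁, d₂) = (−1)^{h(d₁)h(d₂)} ∏_{Q ∈ red(d₂)} H_{d₁}(j(τ_Q))`
(`Res(f, g) = (−1)^{deg f · deg g} Res(g, f)`). [cite: GrossZagier1985SingularModuli, §1] -/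
theorem J_eq_sign_mul_prod_eval_classPolynomial {d₁ d₂ : ℤ} (hd₁ : d₁ < 0) (hd₂ : d₂ < 0) :
    J d₁ d₂ = (-1) ^ (classNumber d₁ * classNumber d₂) *
      ∏ Q ∈ reducedForms d₂, (classPolynomial d₁).eval (formJ Q) := by
  rw [J_eq_prod_prod hd₁ hd₂, Finset.prod_comm]
  have hH : ∀ Q₂ ∈ reducedForms d₂, ∏ Q₁ ∈ reducedForms d₁, (formJ Q₁ - formJ Q₂) =
      (-1) ^ classNumber d₁ * (classPolynomial d₁).eval (formJ Q₂) := by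
    intro Q₂ _
    rw [classPolynomial, eval_prod]
    simp only [eval_sub, eval_X, eval_C]
    rw [classNumber, ← Finset.prod_const, ← Finset.prod_mul_distrib]
    exact Finset.prod_congr rfl fun Q₁ _ => by ring
  rw [Finset.prod_congr rfl hH, Finset.prod_mul_distrib, Finset.prod_const, ← pow_mul, classNumber,
    classNumber]

/-- **`J(d₁, d₂) = Res(H_{d₁}, H_{d₂})`** — literally, with Mathlib's Sylvester-matrix resultant
`Polynomial.resultant` (`d₁, d₂ < 0`; `H_{d₁}` monic and split over `ℂ` with roots the `j(τ_Q)`,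
`Q ∈ reducedForms d₁`, so `Res(H_{d₁}, H_{d₂}) = ∏_Q H_{d₂}(j(τ_Q))` by `Polynomial.resultant_eq_prod_eval`).
[cite: LiYang2020YuiZagier, §1 p. 3 and Thm. 1.4] [cite: GrossZagier1985SingularModuli, §1] -/
theorem J_eq_resultant {d₁ d₂ : ℤ} (hd₁ : d₁ < 0) (hd₂ : d₂ < 0) :
    J d₁ d₂ = (classPolynomial d₁).resultant (classPolynomial d₂) := by
  rw [J_eq_prod_eval_classPolynomial hd₁ hd₂, resultant_eq_prod_eval (classPolynomial d₁)
      (classPolynomial d₂) _ le_rfl (IsAlgClosed.splits _), (monic_classPolynomial d₁).leadingCoeff,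
    one_pow, one_mul, classPolynomial_roots_eq_map_formJ, Multiset.map_map,
    Finset.prod_eq_multiset_prod]
  rfl

/-! ### [GZ85, Thm. 1.3] read in the census's vocabulary -/

/-- **Gross–Zagier, Thm. 1.3, for the census's class polynomials** (corollary of the named fact
`grossZagier1985_singularModuli`, taken as hypothesis): for coprime negative fundamental
discriminants `d₁, d₂`, the resultant-product `∏_{Q ∈ red(d₁)} H_{d₂}(j(τ_Q))` satisfies
`(∏ H_{d₂}(j(τ_Q)))^8 = (∏_{x² < d₁d₂, x ≡ d₁d₂ (2)} F((d₁d₂ − x²)/4))^{w₁w₂}`.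
[cite: GrossZagier1985SingularModuli, Theorem 1.3] -/
theorem _root_.Literature.NumberTheory.EllipticCurves.grossZagier1985_singularModuli.resultant_pow_eight
    (h : grossZagier1985_singularModuli) {d₁ d₂ : ℤ} (hd₁ : d₁ < 0) (hd₂ : d₂ < 0)
    (hf₁ : Literature.Barriers.RiemannHypothesis.IsFundamentalDiscriminant d₁)
    (hf₂ : Literature.Barriers.RiemannHypothesis.IsFundamentalDiscriminant d₂)
    (hg : Int.gcd d₁ d₂ = 1) :
    (∏ Q ∈ reducedForms d₁, (classPolynomial d₂).eval (formJ Q)) ^ 8 =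
      ((rhs d₁ d₂ : ℚ) : ℂ) ^ (unitCount d₁ * unitCount d₂) := by
  rw [← J_eq_prod_eval_classPolynomial hd₁ hd₂]
  exact h d₁ d₂ hd₁ hd₂ hf₁ hf₂ hg

/-- The same with Mathlib's resultant: **`Res(H_{d₁}, H_{d₂})^8 = (∏ₓ F((d₁d₂ − x²)/4))^{w₁w₂}`** for coprime
negative fundamental discriminants (corollary of the named fact `grossZagier1985_singularModuli`, taken
as hypothesis `h`). [cite: GrossZagier1985SingularModuli, Theorem 1.3] -/
theorem _root_.Literature.NumberTheory.EllipticCurves.grossZagier1985_singularModuli.resultant_classPolynomial_pow_eight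
    (h : grossZagier1985_singularModuli) {d₁ d₂ : ℤ} (hd₁ : d₁ < 0) (hd₂ : d₂ < 0)
    (hf₁ : Literature.Barriers.RiemannHypothesis.IsFundamentalDiscriminant d₁)
    (hf₂ : Literature.Barriers.RiemannHypothesis.IsFundamentalDiscriminant d₂)
    (hg : Int.gcd d₁ d₂ = 1) :
    ((classPolynomial d₁).resultant (classPolynomial d₂)) ^ 8 =
      ((rhs d₁ d₂ : ℚ) : ℂ) ^ (unitCount d₁ * unitCount d₂) := by
  rw [← J_eq_resultant hd₁ hd₂]
  exact h d₁ d₂ hd₁ hd₂ hf₁ hf₂ hg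

/-- **The same, UNCONDITIONALLY, on the nine class-number-one fundamental discriminants**
`{−3, −4, −7, −8, −11, −19, −43, −67, −163}` (`cmDiscrs`), from the kernel-checked instances
`grossZagier1985_singularModuli_of_mem_cmDiscrs` (`GrossZagierSingularModuliClassNumberOne.lean`).
[cite: GrossZagier1985SingularModuli, Theorem 1.3] -/
theorem resultant_pow_eight_of_mem_cmDiscrs {d₁ d₂ : ℤ} (hd₁ : d₁ ∈ cmDiscrs) (hd₂ : d₂ ∈ cmDiscrs)
    (hg : Int.gcd d₁ d₂ = 1) :
    (∏ Q ∈ reducedForms d₁, (classPolynomial d₂).eval (formJ Q)) ^ 8 =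
      ((rhs d₁ d₂ : ℚ) : ℂ) ^ (unitCount d₁ * unitCount d₂) := by
  rw [← J_eq_prod_eval_classPolynomial (isFundamentalDiscriminant_of_mem_cmDiscrs hd₁).1
    (isFundamentalDiscriminant_of_mem_cmDiscrs hd₂).1]
  exact grossZagier1985_singularModuli_of_mem_cmDiscrs hd₁ hd₂ hg

/-- **`Res(H_{d₁}, H_{d₂})^8 = (∏ₓ F((d₁d₂ − x²)/4))^{w₁w₂}` UNCONDITIONALLY on `cmDiscrs × cmDiscrs`**
(coprime pairs of the nine class-number-one fundamental discriminants), with Mathlib's resultant.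
[cite: GrossZagier1985SingularModuli, Theorem 1.3] -/
theorem resultant_classPolynomial_pow_eight_of_mem_cmDiscrs {d₁ d₂ : ℤ} (hd₁ : d₁ ∈ cmDiscrs)
    (hd₂ : d₂ ∈ cmDiscrs) (hg : Int.gcd d₁ d₂ = 1) :
    ((classPolynomial d₁).resultant (classPolynomial d₂)) ^ 8 =
      ((rhs d₁ d₂ : ℚ) : ℂ) ^ (unitCount d₁ * unitCount d₂) := by
  rw [← J_eq_resultant (isFundamentalDiscriminant_of_mem_cmDiscrs hd₁).1
    (isFundamentalDiscriminant_of_mem_cmDiscrs hd₂).1]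
  exact grossZagier1985_singularModuli_of_mem_cmDiscrs hd₁ hd₂ hg

end GrossZagier1985

end Literature.NumberTheory.EllipticCurves
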